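import Literature.MathematicalPhysics.QuantumFieldTheory.Balaban1983to89.B8Claim97KLevel

/-!
# `Balaban1983to89.B8SectEKLevelDomains` — [Balaban1985RegularSpaces] Sect. E pp. 95–97 at `k` levels, READ FROM THE NESTED FAMILY
# `{Ω_j}`: the tower-local hypotheses of `B8Eq1117KLevel` («exactly one solution of (1.117)», `D′`, (1.114) on `𝔅_k`) derived from
# print's region-wise conditions «on Ω_j, j = 0, …, k» in the currency of `B8Ineq132` (`InAk` = (1.33), `BondTouches` = «b ∈ Ω_j»)
# — the glue by which the family of record feeds Sect. E by name

statement-level skeleton of published theorems with citation tags; proofs where landed; nothing here is a claim about the Yang–Mills mass gap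

T. Bałaban, *Spaces of regular gauge field configurations on a lattice and gauge fixing conditions*, Commun.
Math. Phys. **99** (1985) 75–102 `[Balaban1985RegularSpaces]` ("B8"; printed page = PDF page + 74), pp. 88–90, 95–97.  PDF held:
`paper:balaban1985-cmp99-regular-spaces-gauge-fixing`.  STATUS: published, refereed.

CITATION HEADER (lean-in-tree rule).  Cell `pub-ymgap` (YM Track A, DAG node N05 = [B8], HUMAN RULING D-0062), seat `pub-ymgap-dag-n05-b`,
gen 0 («Sect. E at k levels»).  WHAT IS REPRODUCED = the READING STEP between print's hypotheses of Theorem 4 / Sect. E — (1.33)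
«U₀ ∈ 𝔄_k({Ω_j}, α₀)», (1.69) «|A| < B₁(α₀ + α₁)(Lʲη)⁻¹ on Ω_j», (1.119) «|λ| < ½α₄, |Dλ| < ½α₄(Lʲη)⁻¹ on Ω_j», (1.92) for `H′` — and the
TOWER-LOCAL hypotheses of this seat's `B8Eq1117KLevel` (data on `Bʲ(y)`, `y ∈ Λ_j`): given the geometric clause `Bʲ(y) ⊂ Ω_j` for `y ∈ Λ_j`
(print: `Λ_j ⊂ 𝔅_k` are sites of the `j`-lattice inside `Ω_j`; cf. `B8Eq156KLevelLocal.hbox_of_domainSeq`), each region-wise condition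
implies the tower-local one.  Kind «kernel-checked proof», theorems only: no `def`, no `… : Prop` fact, no existing module modified.  REUSED
BY NAME: `B8Ineq132.{InAk, CondAt, PlaqTouches, BondTouches, plaqF, pdevOn_lt_of_forall}`, `B7Prop2Explicit.hol_plaqWord_self`,
`B8Eq1117KLevel.exists_Dprime_kLevel_of_axial`, `B8Claim97KLevel.onto_kLevel_of_axial`.

## THE PRINTED TEXT

p. 88: «Let us consider a sequence of domains {Ω_j}, a configuration U₀ ∈ 𝔄_k({Ω_j}, α₀) …»; (1.69) «|A| < B₁(α₀ + α₁)(Lʲη)⁻¹ on Ω_j»;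
p. 96: «Let us assume that |λ| < ½α₄, |Dλ| < ½α₄(Lʲη)⁻¹ on Ω_j, |X| < α₄/(2B′₀). (1.119)»; p. 77: «x ∈ Ω_j … Similarly for the
corresponding set of bonds / plaquettes» (the `BondTouches` / `PlaqTouches` reading of `B8Ineq132`).

## WHAT IS CERTIFIED HERE (kernel; axioms `propext` / `Classical.choice` / `Quot.sound`)

* §1 `pdevOn_tower_of_condAt` — (1.33) at level `j` on `Ω_j` (the plaquette clause of `B8Ineq132.CondAt`) gives `pdevOn (tlo L y j) (thi L y j)
  U₀ < α₀L^{−2j}` on every tower `Bʲ(y) ⊂ Ω_j`; `bond_tower_of_touches`, `site_tower_of_mem` — a bound «on the bonds / sites of Ω_j» gives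
  the bound on the bonds / sites of every box inside `Ω_j`.
* §2 **`exists_Dprime_kLevel_of_domains`** — `B8Eq1117KLevel.exists_Dprime_kLevel_of_axial` with every tower-local hypothesis replaced by
  print's region-wise one: (1.33) as `InAk L k η α₀ Ω U₀`, (1.69) / (1.119) / the `H′`-modulus as bounds on the bonds and sites of `Ω_j`
  (`BondTouches (Ω j)`, `∈ Ω j`), `j ≤ k`, plus the geometric clause `Bʲ(y) ⊂ Ω_j` (`y ∈ Λ_j`); **`onto_kLevel_of_domains`** — the same
  reading for the p. 97 onto sentence (`B8Claim97KLevel.onto_kLevel_of_axial`).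

## HONEST SCOPE — what is NOT claimed

The geometric clause is a hypothesis (for the family of record it is `Λ_j ⊂ Ω_j^{(j)}`, one line from `DomainSeq`); the gradient member of
(1.33)/(1.69) is not used (as in print); everything else as in `B8Eq1117KLevel` (its HONEST SCOPE (i)–(vi)).  Nothing here is progress on the
summit.
-/

noncomputable section

open NormedSpace Finset

namespace Literature.MathematicalPhysics.QuantumFieldTheory.Balaban1983to89.B8SectEKLevelDomains

open B7Prop1Explicit B7Prop2Explicit B7Prop3Flat B7Prop1Local B7Eq167Flat B7Eq167General
open B7Eq170Flat (cj cj_apply)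
open B7Prop10General (C6 C4G)
open B7Prop9Flat (C5')
open B7Eq214General (Cgen)
open B8Ineq130 (tlo thi inBox_of_le)
open B7Eq84Concrete (glev)
open B7Eq92Concrete (mgauge)
open B7Eq78Linearization (zdBlocking QprimeIter)
open B8Eq119TwistedAxial (bgT InAx Restr129)
open B8Eq178Averages (Qnl)
open B8Eq1123Concrete (Cnl)
open B8Ineq125Concrete (C2p)
open B8Eq1117Concrete (XSpace)
open B8Ineq132 (plaqF pdevOn_lt_of_forall CondAt InAk PlaqTouches BondTouches)
open B8Eq1117KLevel (exists_Dprime_kLevel_of_axial)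
open B8Claim97KLevel (onto_kLevel_of_axial)

-- `Site` alone could resolve to the torus sites of `Setup.lean`; re-export the `ℤ^d` sites of `B7Prop1Explicit`.
export B7Prop1Explicit (Site)

variable {d : ℕ}

/-! ## §1 Region-wise ⇒ tower-local -/

section Glue

variable {𝔸 : Type*} [NormedRing 𝔸] [NormOneClass 𝔸] [NormedAlgebra ℂ 𝔸] [CompleteSpace 𝔸]

omit [NormOneClass 𝔸] [NormedAlgebra ℂ 𝔸] [CompleteSpace 𝔸] in
/-- **(1.33) at level `j` «on Ω_j» ⇒ regularity on every tower inside `Ω_j`**: if every plaquette touching `Ω_j` has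
`|U₀(∂p) − 1| < α₀L^{−2j}` (the plaquette clause of `B8Ineq132.CondAt`, p. 77's convention), and the box `[lo, hi] ⊂ Ω_j`, then
`pdevOn lo hi U₀ < α₀L^{−2j}`. [cite: Balaban1985RegularSpaces, (1.33) p.82, (1.8) p.77, p.77 (convention before (1.5))] -/
theorem pdevOn_box_of_plaq {L j : ℕ} {Ω : Set (Site d)} {U₀ : Site d → Fin d → 𝔸ˣ} {α₀ : ℝ} (hα : 0 < α₀) (hL1 : 1 ≤ L)
    {lo hi : Site d} (hbox : ∀ x : Site d, InBox lo hi x → x ∈ Ω)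
    (h33 : ∀ (x : Site d) (μ ν : Fin d), μ ≠ ν → PlaqTouches Ω x μ ν → ‖plaqF U₀ μ ν x - 1‖ < α₀ * (((L : ℝ) ^ j)⁻¹) ^ 2) :
    pdevOn lo hi U₀ < α₀ * (((L : ℝ) ^ j)⁻¹) ^ 2 := by
  have hLj : (0 : ℝ) < (L : ℝ) ^ j := by positivity
  refine pdevOn_lt_of_forall (by positivity) fun x μ ν hx _ => ?_
  rcases eq_or_ne μ ν with rfl | hμν
  · rw [B7Prop2Explicit.hol_plaqWord_self, Units.val_one, sub_self, norm_zero]; positivity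
  · exact h33 x μ ν hμν (Or.inl (hbox x hx))

omit [NormOneClass 𝔸] [NormedAlgebra ℂ 𝔸] [CompleteSpace 𝔸] in
/-- A bound «on the bonds of Ω_j» (`BondTouches`) gives the bound on every bond of a box inside `Ω_j`.
[cite: Balaban1985RegularSpaces, p.77 (convention before (1.5)), (1.69) p.88] -/
theorem bond_box_of_touches {Ω : Set (Site d)} {lo hi : Site d} (hbox : ∀ x : Site d, InBox lo hi x → x ∈ Ω)
    {P : Site d → Fin d → Prop} (h : ∀ (x : Site d) (κ : Fin d), BondTouches Ω x κ → P x κ) :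
    ∀ (x : Site d) (κ : Fin d), InBox lo hi x → InBox lo hi (x + e κ) → P x κ :=
  fun x κ hx _ => h x κ (Or.inl (hbox x hx))

omit [NormOneClass 𝔸] [NormedAlgebra ℂ 𝔸] [CompleteSpace 𝔸] in
/-- A bound «on the sites of Ω_j» gives the bound at every site of a box inside `Ω_j`. [cite: Balaban1985RegularSpaces, (1.119) p.96] -/
theorem site_box_of_mem {Ω : Set (Site d)} {lo hi : Site d} (hbox : ∀ x : Site d, InBox lo hi x → x ∈ Ω)
    {P : Site d → Prop} (h : ∀ x : Site d, x ∈ Ω → P x) : ∀ x : Site d, InBox lo hi x → P x :=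
  fun x hx => h x (hbox x hx)

end Glue

/-! ## §2 `D′(λ)` and (1.114) on `𝔅_k` from print's region-wise hypotheses -/

section Domains

variable {𝔸 : Type*} [NormedRing 𝔸] [NormOneClass 𝔸] [NormedAlgebra ℂ 𝔸] [CompleteSpace 𝔸]

/-- **«WE TAKE D′(λ) EQUAL TO THIS SOLUTION» AND (1.114) AT `k` LEVELS, HYPOTHESES AS PRINTED ON THE NESTED FAMILY** — the theorem
`B8Eq1117KLevel.exists_Dprime_kLevel_of_axial` with: (1.33) as `U₀ ∈ 𝔄_k({Ω_j}, α₀)` (`B8Ineq132.InAk L k η α₀ Ω U₀`; only its plaquette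
clause is used), (1.69) as `‖B_b‖ ≤ cL^{−j}` on the bonds of `Ω_j`, `U₁^{u₁}U₀ ∈ Ax_k(𝔅_k, U₀)` and (1.29) for `u₁` (`InAx`, `Restr129`),
(1.119) for `λ` on the sites and bonds of `Ω_j`, `‖(H′X)(x)‖ ≤ B′₀‖X‖` and the (1.92)-type modulus `‖R(U₀(b))(H′X)(b₊) − (H′X)(b₋)‖ ≤
B′₀‖X‖L^{−j}` on the bonds of `Ω_j`, `Q′H′ = I` on `𝔅_k`, the geometric clause `Bʲ(y) ⊂ Ω_j` for `y ∈ Λ_j`, `j ≤ k`, and the `j`-free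
smallness.  THEN there is `X = D′(λ) ∈ XSpace d k 𝔸`, `‖X‖ ≤ α₄/(2B′₀)`, `‖X‖ ≤ C2p(α₃ + α₄)α₄` (`α₃ = 40d·c`), `X = 0` off `𝔅_k`, solving
(1.117) on `𝔅_k`, with (1.114) `Q′_j(u₁, λ − H′X)(y) = (Q′_jλ)(y)` for `y ∈ Λ_j`, `j ≤ k`.
[cite: Balaban1985RegularSpaces, (1.113)–(1.121) pp.95–97, (1.33) p.82, (1.68)–(1.69) p.88, (1.92) p.91] -/
theorem exists_Dprime_kLevel_of_domains {L : ℕ} (hL : 2 ≤ L) (hL1 : 1 ≤ L) {G : Subgroup 𝔸ˣ} (hG : AvgClosed d L G)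
    {U₀ : Site d → Fin d → 𝔸ˣ} (hU₀ : ∀ x κ, U₀ x κ ∈ G) {k : ℕ} (Ω Λ : ℕ → Set (Site d)) {η : ℝ}
    (H' : XSpace d k 𝔸 →ₗ[ℂ] (Site d → 𝔸)) (lam : Site d → 𝔸) {B : Site d → Fin d → 𝔸} {u₁ : Site d → 𝔸ˣ}
    {α₀ α₄ c B₀' : ℝ}
    (hα : 0 < α₀) (hα3 : C0 d * α₀ ≤ 1 / 3) (hα4 : 4 * α₀ ≤ c2' d L) (hc : 0 ≤ c) (hα₄ : 0 < α₄) (hB : 0 < B₀')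
    (hbox : ∀ j, j ≤ k → ∀ y ∈ Λ j, ∀ x : Site d, InBox (tlo L y j) (thi L y j) x → x ∈ Ω j)
    (h33 : InAk L k η α₀ Ω U₀)
    (h69 : ∀ j, j ≤ k → ∀ (x : Site d) (κ : Fin d), BondTouches (Ω j) x κ → ‖B x κ‖ ≤ c * ((L : ℝ) ^ j)⁻¹)
    (hAx : InAx L k Λ U₀ (mgauge U₀ u₁ (expCfg B) * U₀)) (h129 : Restr129 L k Λ U₀ u₁)
    (h119b : ∀ j, j ≤ k → ∀ x : Site d, x ∈ Ω j → ‖lam x‖ < α₄ / 2)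
    (h119a : ∀ j, j ≤ k → ∀ (x : Site d) (κ : Fin d), BondTouches (Ω j) x κ →
      ‖cj (U₀ x κ) (lam (x + e κ)) - lam x‖ < α₄ / 2 * ((L : ℝ) ^ j)⁻¹)
    (hH0 : ∀ (X : XSpace d k 𝔸) (x : Site d), ‖H' X x‖ ≤ B₀' * ‖X‖)
    (hH1 : ∀ j, j ≤ k → ∀ (X : XSpace d k 𝔸) (x : Site d) (κ : Fin d), BondTouches (Ω j) x κ →
      ‖cj (U₀ x κ) (H' X (x + e κ)) - H' X x‖ ≤ B₀' * ‖X‖ * ((L : ℝ) ^ j)⁻¹)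
    (hQH : ∀ (Y : XSpace d k 𝔸) (j : ℕ) (hj : j ≤ k) (y : Site d), y ∈ Λ j →
      QprimeIter (zdBlocking d L) (bgT L U₀) j (H' Y) y = Y (⟨j, Nat.lt_succ_of_le hj⟩, y))
    (hsmall : Real.exp (4 * (800 * ((d : ℝ) + 1) ^ 2 * ((d : ℝ) + 4)) * α₀) * (1 + 8 * (131072 * ((d : ℝ) + 1) ^ 2) * c) ≤ 2)
    (hc₃ : 2 * c ≤ c3 d L) (hs : 128 * (d : ℝ) * c ≤ 1) (hα₃' : 40 * d * c ≤ 1 / 200)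
    (hs₁ : 200 * C6 d * (2 * α₄) ≤ 1) (hs₂ : 12000 * ((d : ℝ) + 1) * L * (2 * α₄) ≤ 1)
    (hs₃ : C4G d L * (α₀ + 40 * d * c + 4 * (2 * α₄)) ≤ 1)
    (hs₄ : 1024 * ((d : ℝ) + 1) * ((d : ℝ) + 4) * L ^ 2 * α₀ ≤ 1) (hs₅ : 32 * ((d : ℝ) + 1) ^ 2 * C6 d * L ^ 2 * α₀ ≤ 1)
    (hs₆ : 16 * d * C5' d * C6 d * (L : ℝ) ^ 2 * α₀ ≤ 1) (hs₇ : 8 * d * C6 d * L * α₀ ≤ 1)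
    (hsm : 40 * d * c + α₄ ≤ 1 / (4 * B₀' * (2 * C2p d))) :
    ∃ X : XSpace d k 𝔸, ‖X‖ ≤ α₄ / (2 * B₀') ∧ ‖X‖ ≤ C2p d * (40 * d * c + α₄) * α₄ ∧
      (∀ (j : ℕ) (hj : j ≤ k) (y : Site d), y ∉ Λ j → X (⟨j, Nat.lt_succ_of_le hj⟩, y) = 0) ∧
      (∀ (j : ℕ) (hj : j ≤ k) (y : Site d), y ∈ Λ j →
        Cnl L U₀ u₁ j (lam - H' X) y = X (⟨j, Nat.lt_succ_of_le hj⟩, y)) ∧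
      ∀ (j : ℕ), j ≤ k → ∀ y ∈ Λ j,
        Qnl L U₀ (fun x => expUnit ((lam - H' X) x)) u₁ j y = QprimeIter (zdBlocking d L) (bgT L U₀) j lam y :=
  exists_Dprime_kLevel_of_axial hL hL1 hG hU₀ Λ H' lam hα hα3 hα4 hc hα₄ hB
    (fun j hj y hy => pdevOn_box_of_plaq hα hL1 (hbox j hj y hy) (h33 j hj).1)
    (fun j hj y hy => bond_box_of_touches (hbox j hj y hy) (h69 j hj))
    hAx h129
    (fun j hj y hy => site_box_of_mem (hbox j hj y hy) (h119b j hj))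
    (fun j hj y hy => bond_box_of_touches (hbox j hj y hy) (h119a j hj))
    hH0
    (fun j hj y hy X => bond_box_of_touches (hbox j hj y hy) (hH1 j hj X))
    hQH hsmall hc₃ hs hα₃' hs₁ hs₂ hs₃ hs₄ hs₅ hs₆ hs₇ hsm

/-- **THE ONTO SENTENCE OF p. 97 AT `k` LEVELS, HYPOTHESES AS PRINTED ON THE NESTED FAMILY** — `B8Claim97KLevel.onto_kLevel_of_axial`
(explicit inverse `λ = λ′ + H′C′(λ′)` of (1.113)) with (1.33) as `InAk`, (1.69) and the `H′`-modulus on the bonds of `Ω_j`, `λ′` in the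
quarter-size set on the sites and bonds of `Ω_j` («|λ′| < ¼α₄, |Dλ′| < ¼α₄(Lʲη)⁻¹ on Ω_j»), and the clause `Bʲ(y) ⊂ Ω_j`: there are `λ`
(half-size on every tower) and `X = D′(λ)` (in the ball, `0` off `𝔅_k`, solving (1.117) for `λ` on `𝔅_k`) with `λ − H′X = λ′`.
[cite: Balaban1985RegularSpaces, p.97 (onto sentence), (1.113) p.95, (1.119)–(1.121) p.96, (1.33) p.82, (1.69) p.88] -/
theorem onto_kLevel_of_domains {L : ℕ} (hL : 2 ≤ L) (hL1 : 1 ≤ L) {G : Subgroup 𝔸ˣ} (hG : AvgClosed d L G)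
    {U₀ : Site d → Fin d → 𝔸ˣ} (hU₀ : ∀ x κ, U₀ x κ ∈ G) {k : ℕ} (Ω Λ : ℕ → Set (Site d)) {η : ℝ}
    (H' : XSpace d k 𝔸 →ₗ[ℂ] (Site d → 𝔸)) (lam' : Site d → 𝔸) {B : Site d → Fin d → 𝔸} {u₁ : Site d → 𝔸ˣ}
    {α₀ α₄ c B₀' : ℝ}
    (hα : 0 < α₀) (hα3 : C0 d * α₀ ≤ 1 / 3) (hα4 : 4 * α₀ ≤ c2' d L) (hc : 0 ≤ c) (hα₄ : 0 < α₄) (hB : 0 < B₀')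
    (hbox : ∀ j, j ≤ k → ∀ y ∈ Λ j, ∀ x : Site d, InBox (tlo L y j) (thi L y j) x → x ∈ Ω j)
    (h33 : InAk L k η α₀ Ω U₀)
    (h69 : ∀ j, j ≤ k → ∀ (x : Site d) (κ : Fin d), BondTouches (Ω j) x κ → ‖B x κ‖ ≤ c * ((L : ℝ) ^ j)⁻¹)
    (hAx : InAx L k Λ U₀ (mgauge U₀ u₁ (expCfg B) * U₀)) (h129 : Restr129 L k Λ U₀ u₁)
    (hq_b : ∀ j, j ≤ k → ∀ x : Site d, x ∈ Ω j → ‖lam' x‖ < α₄ / 4)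
    (hq_a : ∀ j, j ≤ k → ∀ (x : Site d) (κ : Fin d), BondTouches (Ω j) x κ →
      ‖cj (U₀ x κ) (lam' (x + e κ)) - lam' x‖ < α₄ / 4 * ((L : ℝ) ^ j)⁻¹)
    (hH0 : ∀ (X : XSpace d k 𝔸) (x : Site d), ‖H' X x‖ ≤ B₀' * ‖X‖)
    (hH1 : ∀ j, j ≤ k → ∀ (X : XSpace d k 𝔸) (x : Site d) (κ : Fin d), BondTouches (Ω j) x κ →
      ‖cj (U₀ x κ) (H' X (x + e κ)) - H' X x‖ ≤ B₀' * ‖X‖ * ((L : ℝ) ^ j)⁻¹)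
    (hsmall : Real.exp (4 * (800 * ((d : ℝ) + 1) ^ 2 * ((d : ℝ) + 4)) * α₀) * (1 + 8 * (131072 * ((d : ℝ) + 1) ^ 2) * c) ≤ 2)
    (hc₃ : 2 * c ≤ c3 d L) (hs : 128 * (d : ℝ) * c ≤ 1) (hα₃' : 40 * d * c ≤ 1 / 200)
    (hs₁ : 200 * C6 d * (2 * α₄) ≤ 1) (hs₂ : 12000 * ((d : ℝ) + 1) * L * (2 * α₄) ≤ 1)
    (hs₃ : C4G d L * (α₀ + 40 * d * c + 4 * (2 * α₄)) ≤ 1)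
    (hs₄ : 1024 * ((d : ℝ) + 1) * ((d : ℝ) + 4) * L ^ 2 * α₀ ≤ 1) (hs₅ : 32 * ((d : ℝ) + 1) ^ 2 * C6 d * L ^ 2 * α₀ ≤ 1)
    (hs₆ : 16 * d * C5' d * C6 d * (L : ℝ) ^ 2 * α₀ ≤ 1) (hs₇ : 8 * d * C6 d * L * α₀ ≤ 1)
    (hsm : 40 * d * c + α₄ ≤ 1 / (4 * B₀' * (2 * C2p d))) :
    ∃ (lam : Site d → 𝔸) (X : XSpace d k 𝔸),
      (∀ j, j ≤ k → ∀ y ∈ Λ j, ∀ x : Site d, InBox (tlo L y j) (thi L y j) x → ‖lam x‖ < α₄ / 2) ∧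
      (∀ j, j ≤ k → ∀ y ∈ Λ j, ∀ (x : Site d) (κ : Fin d), InBox (tlo L y j) (thi L y j) x →
        InBox (tlo L y j) (thi L y j) (x + e κ) → ‖cj (U₀ x κ) (lam (x + e κ)) - lam x‖ < α₄ / 2 * ((L : ℝ) ^ j)⁻¹) ∧
      ‖X‖ ≤ α₄ / (2 * B₀') ∧
      (∀ (j : ℕ) (hj : j ≤ k) (y : Site d), y ∉ Λ j → X (⟨j, Nat.lt_succ_of_le hj⟩, y) = 0) ∧
      (∀ (j : ℕ) (hj : j ≤ k) (y : Site d), y ∈ Λ j →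
        Cnl L U₀ u₁ j (lam - H' X) y = X (⟨j, Nat.lt_succ_of_le hj⟩, y)) ∧
      lam - H' X = lam' :=
  onto_kLevel_of_axial hL hL1 hG hU₀ Λ H' lam' hα hα3 hα4 hc hα₄ hB
    (fun j hj y hy => pdevOn_box_of_plaq hα hL1 (hbox j hj y hy) (h33 j hj).1)
    (fun j hj y hy => bond_box_of_touches (hbox j hj y hy) (h69 j hj))
    hAx h129
    (fun j hj y hy => site_box_of_mem (hbox j hj y hy) (hq_b j hj))
    (fun j hj y hy => bond_box_of_touches (hbox j hj y hy) (hq_a j hj))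
    hH0
    (fun j hj y hy X => bond_box_of_touches (hbox j hj y hy) (hH1 j hj X))
    hsmall hc₃ hs hα₃' hs₁ hs₂ hs₃ hs₄ hs₅ hs₆ hs₇ hsm

end Domains

#print axioms exists_Dprime_kLevel_of_domains
#print axioms onto_kLevel_of_domains

end Literature.MathematicalPhysics.QuantumFieldTheory.Balaban1983to89.B8SectEKLevelDomains

end
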